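import Literature.MathematicalPhysics.QuantumFieldTheory.Federbush1986.PhaseCellIVGeomConstruction4

/-!
# Federbush, *A phase cell approach to Yang–Mills theory. IV. The choice of variables* (CMP **114** (1988) 317–343) —
# §11 «Gauge Interpolation – A Herculean Task», pp. 336–339: the gauge distance `d^g` (11.1), the vertex gauge of a maximal
# tree (11.2), the factorisation (11.3), the definition (11.14) of `g(e, r+1)`, Geometric Constructions 2/4 in print's `d^g`
# form, and Geometric Constructions 5, 6 ((11.10)–(11.13)) — TYPED, with the structural statements PROVED

statement-level skeleton of published theorems with citation tags; proofs where landed; nothing here is a claim about the Yang–Mills mass gap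

Cell `lit-balaban`, reader/typer block **r19** (F4 fold owner), inventory row `F4.Def§11` (§11 Gauge interpolation (11.1)–(11.14),
Geometric Constructions 1–6) of `run/shared/lean/pub/lit-balaban/lit-balaban-r19/ROWS-F4.md`; companion of
`PhaseCellIVGeomConstructions` (Constructions 1, 2 = (11.4)–(11.6); p264612), `PhaseCellIVGeomConstruction3` ((11.7)–(11.8);
p299713), `PhaseCellIVGeomConstruction4` (p266275) and the Appendix A files (`PhaseCellIVAppAStatements` p242861, …).

**Source.** P. Federbush, Commun. Math. Phys. **114** (1988) 317–343 [bib `Federbush1988PhaseCellIV`; doi:10.1007/bf01225039;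
lit store `paper:doi-10-1007-bf01225039`; journal page = PDF page + 316], pp. 336–339 [PDF 20–23] READ AS IMAGES (renders
`lit-balaban-r19/renders/f4/f4-p020.png` … `f4-p023.png` of the store holding, sha256 `d1b02f02…`).  Verbatim:

* p. 336: «A *gauge*, `φ(x)`, on a set `𝓈 ⊂ R⁴` is defined as a mapping `φ : x → G`, `x ∈ 𝓈`.  If `φ₁` and `φ₂` are two such
  gauges defined on `𝓈`, we set `d^g(φ₁, φ₂)`, the distance between `φ₁` and `φ₂`, to be
  `d^g(φ₁, φ₂) = Inf_{u∈G} sup_{x∈𝓈} d(uφ₁(x), φ₂(x))`. (11.1)»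
* p. 336–337: «Now let `H_i` be any hypercube of level `r` (and not large field).  Consider the (partial) lattice consisting of
  the vertices and edges of `H_i` (in number `2⁴` and `2⁵` respectively).  We select an arbitrary maximal tree in this
  lattice.  We assign a gauge to the vertices of `H_i`, `φ_i(x)`, with the property that if `e = v_a v_b`, for `e` in the
  maximal tree, then `g(e) = φ_i⁻¹(v_a) φ_i(v_b)`. (11.2)  This condition determines the `φ_i(x)` (on the vertices) uniquely
  up to a change `φ_i(x) → gφ_i(x)` for some fixed `g`.»
* p. 337: «Assume the depth of `H_i` is `r_d(i) ≤ r`.  Let `φ_i^d(x)` be the restriction of `φ_α(x)` to `H_i`, where `H_α` is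
  the level `(r_d(i) − 1)` hypercube containing `H_i`.  We will write `φ_i(x) = φ′_i(x) φ_i^d(x)`, (11.3) and thus actually we
  need only extend `φ′_i(x)` from the vertices to all of `H_i`.»
* p. 337, Geometric Construction 2: «a) `d^g(ᵉφ₁, ᵉφ₂) ≤ c d^g(φ₁, φ₂)` (11.5), b) `Λ₁(ᵉφ₂) ≤ c(Λ₁(ᵉφ₁) + d^g(φ₁, φ₂)/L_r +
  Λ₁(φ₂))` (11.6)»; p. 338, Geometric Construction 4: «We extend `φ₂(x)` on `∂D` to `ᵉφ₂(x)` on `D`, satisfying (11.5) and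
  (11.6).»
* p. 338: «If the mapping `φ′ : ∂H → G` (11.9) is homotopically trivial we will use the same *Geometric Construction 3* to
  accomplish an extension `ᵉφ′` to all of `H` satisfying (11.7) and (11.8).  In this case we modify this `ᵉφ′(x)` defined on
  `H` to `ᵉˢφ′(x)` defined on `H` [this becomes the `φ′(x)` of (11.3)].  `ᵉˢφ′` is a smoothing of `ᵉφ′`.
  *Geometric Construction 5.* `ᵉˢφ′(x)` satisfies a) `ᵉˢφ′(x) = ᵉφ′(x)`, `x ∈ ∂H`, (11.10) b) `|D^α ᵉˢφ′(x)| ≤ c_α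
  (1/(d(x, ∂D))^{|α|−1}) Λ₁(ᵉφ′)`, (11.11) where the norm on derivatives in the left side of (11.11) is any reasonable `L_∞`
  norm.  We finally consider `φ′(x)` defined on `∂H` of hypercube `H` where `φ′` is not a homotopically trivial map from `∂H`
  to `G`.  In this case we find an extension, discontinuous at one point `x₀`.  `x₀` is picked as a point in `H` with the
  following property: *Centering Property.* …  *Geometric Construction 6.* `ᵉφ′(x)` defined on `H − x₀`, as an extension of
  `φ′(x)` defined on `∂H`, satisfies a) `ᵉφ′(x) = φ′(x)`, `x ∈ ∂H`, (11.12)» p. 339: «b) `|D^α ᵉφ′(x)| ≤ c_α · Max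
  (1/(d(x, ∂D))^{|α|−1}, 1/(d(x, x₀))^{|α|−1}) · (L_r/d(x, x₀)) · Λ₁(φ′)`. (11.13)  Finally we come to specifying the
  `g(e, r+1)`.  Let `e`, level `> r`, be `v_a v_b` and `e ∈ H_i`, `H_i` level `r`; then we set `g(e, r+1) = φ_i⁻¹(v_a) φ_i(v_b)`,
  (11.14) …  *Caution.* The geometric theorems of Appendix A, require a universal bound on `Λ₁` of `φ`'s (as scaled to unit
  scale) and it is important to check our construction maintains such where we use these theorems.»

**What this file does (and does NOT do).**
* §1 `PhaseCellIVGauge.gaugeDist Γ φ₁ φ₂` = (11.1) for gauges `φ₁ φ₂ : X → Y` and a group `Γ` acting on the target `Y`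
  (print: `Y = Γ = G`, the action = left multiplication, `d` a left-invariant metric on `G`; the embedded reading of the App. A
  files, `Y = ↥M`, `M ⊆ Rᵗ`, is covered by the same definition), in `ℝ≥0∞` like the tree's `Λ₁ = lipConst` and `d^M = supDist`.
  PROVED: `d^g ≤ d^M`, invariance under `φ₁ ↦ uφ₁` / `φ₂ ↦ uφ₂`, `d^g(φ, φ) = 0`, symmetry, triangle inequality (so `d^g` is a
  pseudo-distance on gauges modulo global left multiplication, for an ISOMETRIC action = print's left-invariant `d`), and the
  infimum is ATTAINED for a compact `Γ` acting continuously (`exists_gaugeDist_eq`; print's `G` is compact).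
* §2 (11.2) PROVED as a theorem about trees: for every tree `T` and every edge assignment `g` with `g(−e) = g(e)⁻¹` there is a
  vertex gauge `φ` with `g(v_a v_b) = φ(v_a)⁻¹ φ(v_b)` on the tree edges (`exists_vertexGauge`), unique up to `φ ↦ uφ`
  (`vertexGauge_unique`, for every connected `T`); the vertex–edge lattice of the `n`-cube (`cubeVertexGraph n`) is connected,
  has `2ⁿ` vertices, a maximal tree, and for `n = 4` exactly `2⁵ = 32` edges (print's «`2⁴` and `2⁵`»).
* §3 (11.3) and (11.14) as definitions with their one-line algebra (`primedGauge`, `nextApprox`; `nextApprox` is a pure gauge: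
  cocycle identities PROVED).
* §4 Geometric Constructions 2 and 4 with print's `d^g` of (11.1) in (11.5)–(11.6) (`GeomConstruction2Gauge`,
  `GeomConstruction4Gauge`): the tree's `GeomConstruction2`/`GeomConstruction4` (p264612/p266275) read `d^g` as the sup-distance
  `d^M` (= the `u = Id` term of (11.1)); here the printed form is DERIVED from them for every isometric, continuous action of a
  compact group `Γ` on `↥M` (`GeomConstruction2.gauge`, `GeomConstruction4.gauge`), hence for every compact `C^∞` submanifold
  `M ⊂ Rᵗ` with such an action (`geomConstruction2Gauge_of_submanifold`, `geomConstruction4Gauge_of_submanifold`).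
* §5 Geometric Constructions 5 and 6 ((11.10)–(11.11), (11.12)–(11.13)) TYPED at unit scale («as scaled to unit scale»,
  Caution p. 339; capped like the decls of record `ThmA3ContCap`/`ThmA4ContCap` of Theorems A.3/A.4, which are their ball
  versions), embedded reading; `Prop`-valued definitions, NOT asserted and NOT proved here (print: Appendix A parts C, D prove
  the ball versions; the transport ball → cube of `PhaseCellIVGeomConstruction4` is only bi-Lipschitz and does not carry
  derivative bounds).  The «Centering Property» of `x₀` (a statement about the lattice hierarchy of §1) is typed with §1 in
  `PhaseCellIVLatticeHierarchy`; here `x₀` ranges over the points within `δ` of the centre of the cube (print: `δ = L_{r+1}`,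
  i.e. `1/N` at unit scale), the constants depending on `δ`.
No new axioms; no `sorry`; every declaration carries its citation tag.
-/

namespace Literature.MathematicalPhysics.QuantumFieldTheory.Federbush1986

noncomputable section

open scoped NNReal ENNReal ContDiff
open Set Metric

/-! ## 0. Two more facts about the sup-distance `d^M` of (A.17) (tree: `PhaseCellIVAppA.supDist`, p242861) -/

namespace PhaseCellIVAppA

/-- `d^M` is symmetric. [cite: Federbush1988PhaseCellIV, (A.17) p. 341] -/
theorem supDist_comm {X Y : Type*} [PseudoEMetricSpace Y] (g₁ g₂ : X → Y) : supDist g₁ g₂ = supDist g₂ g₁ := by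
  simp only [supDist, edist_comm]

/-- `d^M` satisfies the triangle inequality. [cite: Federbush1988PhaseCellIV, (A.17) p. 341] -/
theorem supDist_triangle {X Y : Type*} [PseudoEMetricSpace Y] (g₁ g₂ g₃ : X → Y) :
    supDist g₁ g₃ ≤ supDist g₁ g₂ + supDist g₂ g₃ :=
  iSup_le fun x => (edist_triangle _ (g₂ x) _).trans
    (add_le_add (edist_le_supDist g₁ g₂ x) (edist_le_supDist g₂ g₃ x))

/-- `d^M(g, g) = 0`. [cite: Federbush1988PhaseCellIV, (A.17) p. 341] -/
theorem supDist_self {X Y : Type*} [PseudoEMetricSpace Y] (g : X → Y) : supDist g g = 0 := by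
  simp [supDist]

/-- A global gauge transformation `u` acting isometrically on the target does not change `d^M`:
`d^M(ug₁, ug₂) = d^M(g₁, g₂)`. [cite: Federbush1988PhaseCellIV, (11.1) p. 336; (A.17) p. 341] -/
theorem supDist_smul {Γ X Y : Type*} [PseudoEMetricSpace Y] [SMul Γ Y] [IsIsometricSMul Γ Y] (u : Γ) (g₁ g₂ : X → Y) :
    supDist (u • g₁) (u • g₂) = supDist g₁ g₂ := by
  simp only [supDist, Pi.smul_apply, edist_smul_left]

/-- … nor `Λ₁`: `Λ₁(ug) = Λ₁(g)`. [cite: Federbush1988PhaseCellIV, (11.4) p. 337; (11.1) p. 336] -/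
theorem lipConst_smul {Γ X Y : Type*} [PseudoEMetricSpace X] [PseudoEMetricSpace Y] [SMul Γ Y] [IsIsometricSMul Γ Y]
    (u : Γ) (g : X → Y) : lipConst (u • g) = lipConst g := by
  simp only [lipConst, Pi.smul_apply, edist_smul_left]

end PhaseCellIVAppA

namespace PhaseCellIVGauge

open PhaseCellIVAppA

/-! ## 1. (11.1) the gauge distance `d^g(φ₁, φ₂) = Inf_{u ∈ G} sup_{x ∈ 𝓈} d(uφ₁(x), φ₂(x))` -/

section GaugeDist

variable {Γ : Type*} {X Y : Type*} [PseudoEMetricSpace Y]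

variable (Γ) in
/-- **(11.1)** p. 336: «If `φ₁` and `φ₂` are two such gauges defined on `𝓈`, we set `d^g(φ₁, φ₂)`, the distance between `φ₁`
and `φ₂`, to be `d^g(φ₁, φ₂) = Inf_{u∈G} sup_{x∈𝓈} d(uφ₁(x), φ₂(x))`.»  Here the gauges are `φ₁ φ₂ : X → Y` (`X` = the set
`𝓈`), `Γ` (= print's `G`) acts on the target `Y` (print: `Y = G`, `u` acting by left multiplication), the inner `sup` is the
tree's `d^M = supDist` of (A.17), and the value lies in `ℝ≥0∞` (like `Λ₁`).  The term `u = 1` shows `d^g ≤ d^M`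
(`gaugeDist_le_supDist`). [cite: Federbush1988PhaseCellIV, (11.1) p. 336] -/
def gaugeDist [SMul Γ Y] (φ₁ φ₂ : X → Y) : ℝ≥0∞ := ⨅ u : Γ, supDist (u • φ₁) φ₂

/-- Every `u` bounds the infimum: `d^g(φ₁, φ₂) ≤ sup_x d(uφ₁(x), φ₂(x))`. [cite: Federbush1988PhaseCellIV, (11.1) p. 336] -/
theorem gaugeDist_le_supDist_smul [SMul Γ Y] (u : Γ) (φ₁ φ₂ : X → Y) : gaugeDist Γ φ₁ φ₂ ≤ supDist (u • φ₁) φ₂ :=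
  iInf_le _ u

/-- `d^g ≤ d^M` (the term `u = 1` of (11.1)). [cite: Federbush1988PhaseCellIV, (11.1) p. 336; (A.17) p. 341] -/
theorem gaugeDist_le_supDist [Monoid Γ] [MulAction Γ Y] (φ₁ φ₂ : X → Y) : gaugeDist Γ φ₁ φ₂ ≤ supDist φ₁ φ₂ := by
  simpa only [one_smul] using gaugeDist_le_supDist_smul (1 : Γ) φ₁ φ₂

/-- `d^g(φ, φ) = 0`. [cite: Federbush1988PhaseCellIV, (11.1) p. 336] -/
theorem gaugeDist_self [Monoid Γ] [MulAction Γ Y] (φ : X → Y) : gaugeDist Γ φ φ = 0 :=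
  le_antisymm ((gaugeDist_le_supDist φ φ).trans (supDist_self φ).le) bot_le

/-- `d^g` does not see a global left multiplication of the first gauge: `d^g(uφ₁, φ₂) = d^g(φ₁, φ₂)` (re-index the infimum
by `v ↦ vu`). [cite: Federbush1988PhaseCellIV, (11.1) p. 336; (11.2) p. 337 («uniquely up to a change `φ_i(x) → gφ_i(x)`»)] -/
theorem gaugeDist_smul_left [Group Γ] [MulAction Γ Y] (u : Γ) (φ₁ φ₂ : X → Y) :
    gaugeDist Γ (u • φ₁) φ₂ = gaugeDist Γ φ₁ φ₂ := by
  unfold gaugeDist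
  simp only [smul_smul]
  exact Equiv.iInf_congr (Equiv.mulRight u) fun v => rfl

/-- … nor of the second gauge, when the action is ISOMETRIC (print: `d` left-invariant): `d^g(φ₁, uφ₂) = d^g(φ₁, φ₂)`.
[cite: Federbush1988PhaseCellIV, (11.1) p. 336] -/
theorem gaugeDist_smul_right [Group Γ] [MulAction Γ Y] [IsIsometricSMul Γ Y] (u : Γ) (φ₁ φ₂ : X → Y) :
    gaugeDist Γ φ₁ (u • φ₂) = gaugeDist Γ φ₁ φ₂ := by
  unfold gaugeDist
  have h : ∀ v : Γ, supDist (v • φ₁) (u • φ₂) = supDist ((u⁻¹ * v) • φ₁) φ₂ := fun v => by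
    rw [← supDist_smul u⁻¹ (v • φ₁) (u • φ₂), smul_smul, inv_smul_smul]
  simp only [h]
  exact Equiv.iInf_congr (Equiv.mulLeft u⁻¹) fun v => rfl

/-- `d^g` is symmetric (isometric action): `d^g(φ₁, φ₂) = d^g(φ₂, φ₁)` — `sup_x d(vφ₁(x), φ₂(x)) = sup_x d(v⁻¹φ₂(x), φ₁(x))`.
[cite: Federbush1988PhaseCellIV, (11.1) p. 336] -/
theorem gaugeDist_comm [Group Γ] [MulAction Γ Y] [IsIsometricSMul Γ Y] (φ₁ φ₂ : X → Y) :
    gaugeDist Γ φ₁ φ₂ = gaugeDist Γ φ₂ φ₁ := by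
  unfold gaugeDist
  have h : ∀ v : Γ, supDist (v • φ₁) φ₂ = supDist (v⁻¹ • φ₂) φ₁ := fun v => by
    rw [supDist_comm, ← supDist_smul v⁻¹ φ₂ (v • φ₁), inv_smul_smul]
  simp only [h]
  exact Equiv.iInf_congr (Equiv.inv Γ) fun v => rfl

/-- `d^g` satisfies the triangle inequality (isometric action): with `u` for `(φ₁, φ₂)` and `v` for `(φ₂, φ₃)` use `vu` for
`(φ₁, φ₃)`. [cite: Federbush1988PhaseCellIV, (11.1) p. 336] -/
theorem gaugeDist_triangle [Group Γ] [MulAction Γ Y] [IsIsometricSMul Γ Y] (φ₁ φ₂ φ₃ : X → Y) :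
    gaugeDist Γ φ₁ φ₃ ≤ gaugeDist Γ φ₁ φ₂ + gaugeDist Γ φ₂ φ₃ := by
  unfold gaugeDist
  rw [ENNReal.iInf_add]
  refine le_iInf fun u => ?_
  rw [ENNReal.add_iInf]
  refine le_iInf fun v => ?_
  calc (⨅ w : Γ, supDist (w • φ₁) φ₃) ≤ supDist ((v * u) • φ₁) φ₃ := iInf_le _ (v * u)
    _ ≤ supDist ((v * u) • φ₁) (v • φ₂) + supDist (v • φ₂) φ₃ := supDist_triangle _ _ _
    _ = supDist (u • φ₁) φ₂ + supDist (v • φ₂) φ₃ := by rw [← smul_smul, supDist_smul]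

/-- The infimum in (11.1) is ATTAINED when `Γ` is compact and acts continuously (print's `G`: a compact Lie group): there is
`u ∈ G` with `d^g(φ₁, φ₂) = sup_x d(uφ₁(x), φ₂(x))`.  (`u ↦ sup_x d(uφ₁(x), φ₂(x))` is lower semicontinuous as a supremum of
continuous functions, and a lower semicontinuous function on a compact space attains its infimum.)
[cite: Federbush1988PhaseCellIV, (11.1) p. 336] -/
theorem exists_gaugeDist_eq [SMul Γ Y] [TopologicalSpace Γ] [CompactSpace Γ] [Nonempty Γ] [ContinuousSMul Γ Y]
    (φ₁ φ₂ : X → Y) : ∃ u : Γ, gaugeDist Γ φ₁ φ₂ = supDist (u • φ₁) φ₂ := by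
  have hlsc : LowerSemicontinuous fun u : Γ => supDist (u • φ₁) φ₂ := by
    refine lowerSemicontinuous_iSup fun x => Continuous.lowerSemicontinuous ?_
    simp only [Pi.smul_apply]
    fun_prop
  obtain ⟨u, -, hu⟩ := (hlsc.lowerSemicontinuousOn univ).exists_isMinOn univ_nonempty isCompact_univ
  exact ⟨u, le_antisymm (iInf_le _ u) (le_iInf fun v => hu (mem_univ v))⟩

/-- Print's own instance of the setting: `Y = Γ = G` a group acting on itself by LEFT multiplication, so that
`(uφ)(x) = u·φ(x)` and (11.1) reads literally `Inf_u sup_x d(uφ₁(x), φ₂(x))`; «left-invariant metric» = `IsIsometricSMul G G`.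
[cite: Federbush1988PhaseCellIV, (11.1) p. 336] -/
theorem gaugeDist_eq_iInf_group {G : Type*} [Group G] [PseudoEMetricSpace G] (φ₁ φ₂ : X → G) :
    gaugeDist G φ₁ φ₂ = ⨅ u : G, ⨆ x, edist (u * φ₁ x) (φ₂ x) := rfl

end GaugeDist

/-! ## 2. (11.2) the vertex gauge of a maximal tree: existence, and uniqueness up to `φ ↦ gφ` -/

section TreeGauge

open SimpleGraph

variable {V G : Type*} [Group G] {T : SimpleGraph V}

/-- The ordered product `g(e₁)g(e₂)⋯g(e_k)` of the edge variables along a walk `v₀ → v₁ → ⋯ → v_k` (used to build the vertex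
gauge of (11.2) from the unique tree paths). [cite: Federbush1988PhaseCellIV, (11.2) p. 337] -/
def walkProd (g : V → V → G) : ∀ {a b : V}, T.Walk a b → G
  | _, _, Walk.nil => 1
  | _, _, Walk.cons (u := a) (v := x) _ p => g a x * walkProd g p

/-- `walkProd` of the trivial walk. [cite: Federbush1988PhaseCellIV, (11.2) p. 337] -/
@[simp] theorem walkProd_nil (g : V → V → G) (a : V) : walkProd g (Walk.nil : T.Walk a a) = 1 := rfl

/-- `walkProd` of a walk with a first edge. [cite: Federbush1988PhaseCellIV, (11.2) p. 337] -/
@[simp] theorem walkProd_cons (g : V → V → G) {a x b : V} (h : T.Adj a x) (p : T.Walk x b) :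
    walkProd g (Walk.cons h p) = g a x * walkProd g p := rfl

/-- `walkProd` is multiplicative under concatenation. [cite: Federbush1988PhaseCellIV, (11.2) p. 337] -/
theorem walkProd_append (g : V → V → G) {a b c : V} (p : T.Walk a b) (q : T.Walk b c) :
    walkProd g (p.append q) = walkProd g p * walkProd g q := by
  induction p with
  | nil => simp
  | cons h p ih => simp [ih, mul_assoc]

/-- `walkProd` of a walk with a last edge. [cite: Federbush1988PhaseCellIV, (11.2) p. 337] -/
theorem walkProd_concat (g : V → V → G) {a b c : V} (p : T.Walk a b) (h : T.Adj b c) :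
    walkProd g (p.concat h) = walkProd g p * g b c := by
  rw [Walk.concat_eq_append, walkProd_append]
  simp

/-- **(11.2), existence** p. 337: «We assign a gauge to the vertices of `H_i`, `φ_i(x)`, with the property that if
`e = v_a v_b`, for `e` in the maximal tree, then `g(e) = φ_i⁻¹(v_a) φ_i(v_b)`.»  For EVERY tree `T` (print: a maximal tree of
the vertex–edge lattice of the hypercube `H_i`) and every assignment `g` of group elements to its oriented edges with
`g(−e) = g(e)⁻¹` (§1 p. 322: «If `e′` is `e` with the opposite orientation we must have `g(e′) = g⁻¹(e)`») there is a vertex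
gauge `φ` with `g(v_a v_b) = φ(v_a)⁻¹ φ(v_b)` on every tree edge.  PROOF: `φ(v)` = the product of the `g` along the unique
tree path from a root to `v`. [cite: Federbush1988PhaseCellIV, (11.2) p. 337] -/
theorem exists_vertexGauge (hT : T.IsTree) (g : V → V → G) (hg : ∀ a b, T.Adj a b → g b a = (g a b)⁻¹) :
    ∃ φ : V → G, ∀ a b, T.Adj a b → g a b = (φ a)⁻¹ * φ b := by
  classical
  obtain ⟨v₀⟩ := hT.1.nonempty
  have hP : ∀ v, ∃ p : T.Walk v₀ v, p.IsPath := fun v =>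
    ⟨(hT.1 v₀ v).some.toPath, (hT.1 v₀ v).some.toPath.2⟩
  choose P hPp using hP
  refine ⟨fun v => walkProd g (P v), fun a b hab => ?_⟩
  by_cases ha : a ∈ (P b).support
  · have hb : P b = (P a).concat hab := hT.2.path_concat (hPp a) (hPp b) hab ha
    simp only [hb, walkProd_concat, inv_mul_cancel_left]
  · have hb' : b ∈ (P a).support :=
      hT.2.mem_support_of_ne_mem_support_of_adj_of_isPath (hPp a) (hPp b) hab ha
    have ha' : P a = (P b).concat hab.symm := hT.2.path_concat (hPp b) (hPp a) hab.symm hb'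
    simp only [ha', walkProd_concat, hg a b hab, mul_inv_rev, inv_inv, inv_mul_cancel_right]

/-- **(11.2), uniqueness** p. 337: «This condition determines the `φ_i(x)` (on the vertices) uniquely up to a change
`φ_i(x) → gφ_i(x)` for some fixed `g`.»  For every CONNECTED `T`: two vertex gauges reproducing the same `g` on the edges of
`T` differ by a global left multiplication. [cite: Federbush1988PhaseCellIV, (11.2) p. 337] -/
theorem vertexGauge_unique (hT : T.Connected) (g : V → V → G) {φ ψ : V → G}
    (hφ : ∀ a b, T.Adj a b → g a b = (φ a)⁻¹ * φ b) (hψ : ∀ a b, T.Adj a b → g a b = (ψ a)⁻¹ * ψ b) :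
    ∃ u : G, ∀ v, ψ v = u * φ v := by
  obtain ⟨v₀⟩ := hT.nonempty
  refine ⟨ψ v₀ * (φ v₀)⁻¹, fun v => ?_⟩
  have key : ∀ {a b : V} (_ : T.Walk a b), ψ a = ψ v₀ * (φ v₀)⁻¹ * φ a → ψ b = ψ v₀ * (φ v₀)⁻¹ * φ b := by
    intro a b p
    induction p with
    | nil => exact id
    | cons h p ih =>
      rename_i a x b'
      intro ha
      apply ih
      have e1 : φ x = φ a * g a x := by rw [hφ a x h, mul_inv_cancel_left]
      have e2 : ψ x = ψ a * g a x := by rw [hψ a x h, mul_inv_cancel_left]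
      rw [e2, ha, e1, mul_assoc]
  exact key (hT v₀ v).some (by simp)

/-- The uniqueness clause in the form «`ψ = uφ`» (a global left multiplication, Mathlib's `u • φ`).
[cite: Federbush1988PhaseCellIV, (11.2) p. 337] -/
theorem vertexGauge_unique' (hT : T.Connected) (g : V → V → G) {φ ψ : V → G}
    (hφ : ∀ a b, T.Adj a b → g a b = (φ a)⁻¹ * φ b) (hψ : ∀ a b, T.Adj a b → g a b = (ψ a)⁻¹ * ψ b) :
    ∃ u : G, ψ = u • φ := by
  obtain ⟨u, hu⟩ := vertexGauge_unique hT g hφ hψ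
  exact ⟨u, funext fun v => by rw [hu v, Pi.smul_apply, smul_eq_mul]⟩

/-- Conversely a global left multiplication does not change the edge values `φ(v_a)⁻¹φ(v_b)`.
[cite: Federbush1988PhaseCellIV, (11.2) p. 337] -/
theorem vertexGauge_smul (φ : V → G) (u : G) (a b : V) : ((u • φ) a)⁻¹ * (u • φ) b = (φ a)⁻¹ * φ b := by
  simp only [Pi.smul_apply, smul_eq_mul, mul_inv_rev]
  rw [mul_assoc, inv_mul_cancel_left]

/-- The vertex–edge lattice of an `n`-dimensional hypercube: vertices `{0,1}ⁿ`, two vertices joined by an edge iff they differ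
in exactly one coordinate («the (partial) lattice consisting of the vertices and edges of `H_i` (in number `2⁴` and `2⁵`
respectively)», p. 336–337; `n = 4` in print). [cite: Federbush1988PhaseCellIV, §11 p. 336–337] -/
def cubeVertexGraph (n : ℕ) : SimpleGraph (Fin n → Fin 2) where
  Adj v w := hammingDist v w = 1
  symm := ⟨fun v w h => by rwa [hammingDist_comm]⟩
  loopless := ⟨fun v h => by simp at h⟩

/-- Adjacency in the hypercube lattice = Hamming distance one. [cite: Federbush1988PhaseCellIV, §11 p. 336–337] -/
@[simp] theorem cubeVertexGraph_adj {n : ℕ} (v w : Fin n → Fin 2) :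
    (cubeVertexGraph n).Adj v w ↔ hammingDist v w = 1 := Iff.rfl

/-- Adjacency in the hypercube lattice is decidable (so that its edges can be counted, `card_cubeEdges_four`).
[cite: Federbush1988PhaseCellIV, §11 p. 336–337] -/
instance (n : ℕ) : DecidableRel (cubeVertexGraph n).Adj := fun v w =>
  decidable_of_iff _ (cubeVertexGraph_adj v w).symm

/-- «in number `2⁴`»: the hypercube of dimension `n` has `2ⁿ` vertices. [cite: Federbush1988PhaseCellIV, §11 p. 337] -/
theorem card_cubeVertices (n : ℕ) : Fintype.card (Fin n → Fin 2) = 2 ^ n := by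
  simp

/-- «and `2⁵` respectively»: the four-dimensional hypercube has `32` edges. [cite: Federbush1988PhaseCellIV, §11 p. 337] -/
theorem card_cubeEdges_four : (cubeVertexGraph 4).edgeFinset.card = 2 ^ 5 := by
  decide

/-- Flipping one coordinate is an edge of the hypercube lattice. [cite: Federbush1988PhaseCellIV, §11 p. 336–337] -/
theorem cubeVertexGraph_adj_update {n : ℕ} (v : Fin n → Fin 2) (i : Fin n) (a : Fin 2) (ha : v i ≠ a) :
    (cubeVertexGraph n).Adj v (Function.update v i a) := by
  rw [cubeVertexGraph_adj]
  unfold hammingDist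
  rw [Finset.card_eq_one]
  refine ⟨i, ?_⟩
  ext j
  simp only [Finset.mem_filter, Finset.mem_univ, true_and, Finset.mem_singleton]
  by_cases hj : j = i
  · subst hj; simp [ha]
  · simp [hj]

/-- Every vertex of the hypercube lattice is joined to the corner `0` (flip the non-zero coordinates one at a time).
[cite: Federbush1988PhaseCellIV, §11 p. 336–337] -/
theorem cubeVertexGraph_reachable_zero {n : ℕ} (v : Fin n → Fin 2) : (cubeVertexGraph n).Reachable v 0 := by
  induction hk : hammingDist v 0 generalizing v with
  | zero => rw [hammingDist_eq_zero] at hk; rw [hk]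
  | succ k ih =>
    have hne : v ≠ 0 := by
      intro h; rw [h, hammingDist_self] at hk; exact Nat.succ_ne_zero k hk.symm
    obtain ⟨i, hi⟩ : ∃ i, v i ≠ 0 := by
      by_contra h; push Not at h; exact hne (funext h)
    have hadj := cubeVertexGraph_adj_update v i 0 hi
    refine hadj.reachable.trans (ih (Function.update v i 0) ?_)
    unfold hammingDist at hk ⊢
    have : (Finset.univ.filter fun j => v j ≠ (0 : Fin n → Fin 2) j) =
        insert i (Finset.univ.filter fun j => Function.update v i 0 j ≠ (0 : Fin n → Fin 2) j) := by
      ext j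
      simp only [Finset.mem_filter, Finset.mem_univ, true_and, Finset.mem_insert, Pi.zero_apply]
      by_cases hj : j = i
      · subst hj; simp [hi]
      · simp [hj]
    rw [this, Finset.card_insert_of_notMem (by simp)] at hk
    omega

/-- The vertex–edge lattice of the hypercube is connected … [cite: Federbush1988PhaseCellIV, §11 p. 336–337] -/
theorem cubeVertexGraph_connected (n : ℕ) : (cubeVertexGraph n).Connected :=
  ⟨fun v w => (cubeVertexGraph_reachable_zero v).trans (cubeVertexGraph_reachable_zero w).symm⟩

/-- … so «We select an arbitrary maximal tree in this lattice» is possible: a maximal (= spanning) tree exists.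
[cite: Federbush1988PhaseCellIV, §11 p. 337] -/
theorem exists_maximalTree (n : ℕ) : ∃ T ≤ cubeVertexGraph n, T.IsTree :=
  (cubeVertexGraph_connected n).exists_isTree_le

/-- **(11.2) for the hypercube**, as used in print: for every maximal tree `T` of the vertex–edge lattice of the hypercube and
every edge assignment `g` (with `g(−e) = g(e)⁻¹`) there is a vertex gauge `φ_i` on the `2ⁿ` vertices with
`g(e) = φ_i⁻¹(v_a)φ_i(v_b)` for the tree edges, and any two such differ by `φ_i ↦ gφ_i`.
[cite: Federbush1988PhaseCellIV, (11.2) p. 337] -/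
theorem exists_vertexGauge_cube {n : ℕ} {T : SimpleGraph (Fin n → Fin 2)} (hT : T.IsTree)
    (g : (Fin n → Fin 2) → (Fin n → Fin 2) → G) (hg : ∀ a b, T.Adj a b → g b a = (g a b)⁻¹) :
    (∃ φ : (Fin n → Fin 2) → G, ∀ a b, T.Adj a b → g a b = (φ a)⁻¹ * φ b) ∧
      ∀ φ ψ : (Fin n → Fin 2) → G, (∀ a b, T.Adj a b → g a b = (φ a)⁻¹ * φ b) →
        (∀ a b, T.Adj a b → g a b = (ψ a)⁻¹ * ψ b) → ∃ u : G, ψ = u • φ :=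
  ⟨exists_vertexGauge hT g hg, fun _ _ hφ hψ => vertexGauge_unique' hT.1 g hφ hψ⟩

end TreeGauge

/-! ## 3. (11.3) `φ_i = φ′_i φ_i^d` and (11.14) `g(e, r+1) = φ_i⁻¹(v_a) φ_i(v_b)` -/

section Factorisation

variable {X G : Type*} [Group G]

/-- **(11.3)** p. 337: «Let `φ_i^d(x)` be the restriction of `φ_α(x)` to `H_i` … We will write `φ_i(x) = φ′_i(x) φ_i^d(x)`, (11.3)
and thus actually we need only extend `φ′_i(x)`»: the PRIMED gauge `φ′_i := φ_i (φ_i^d)⁻¹` relative to the inherited gauge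
`φ_i^d`. [cite: Federbush1988PhaseCellIV, (11.3) p. 337] -/
def primedGauge (φd φ : X → G) : X → G := fun x => φ x * (φd x)⁻¹

/-- (11.3) as printed: `φ_i(x) = φ′_i(x) φ_i^d(x)`. [cite: Federbush1988PhaseCellIV, (11.3) p. 337] -/
@[simp] theorem primedGauge_mul (φd φ : X → G) (x : X) : primedGauge φd φ x * φd x = φ x := by
  simp [primedGauge]

/-- The primed gauge of `φ_i = φ′ φ_i^d` is `φ′` (the factorisation (11.3) is unique). [cite: Federbush1988PhaseCellIV, (11.3) p. 337] -/
theorem primedGauge_eq_iff (φd φ φ' : X → G) : primedGauge φd φ = φ' ↔ ∀ x, φ x = φ' x * φd x := by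
  constructor
  · rintro rfl x; simp
  · intro h; funext x; simp [primedGauge, h x]

/-- «We consider hypercubes of level `(r(E) − 1)` to have had the identity field `φ(x) = Id` all `x`, as gauge» (p. 336): with
the identity as inherited gauge, `φ′_i = φ_i`. [cite: Federbush1988PhaseCellIV, §11 p. 336; (11.3) p. 337] -/
@[simp] theorem primedGauge_one (φ : X → G) : primedGauge 1 φ = φ := by
  funext x; simp [primedGauge]

/-- **(11.14)** p. 339: «Let `e`, level `> r`, be `v_a v_b` and `e ∈ H_i`, `H_i` level `r`; then we set
`g(e, r+1) = φ_i⁻¹(v_a) φ_i(v_b)`» — the edge variables of the next approximate field assignment, read off the gauge `φ_i`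
of the hypercube (the same expression as the right side of (11.2)). [cite: Federbush1988PhaseCellIV, (11.14) p. 339] -/
def nextApprox (φ : X → G) (va vb : X) : G := (φ va)⁻¹ * φ vb

/-- `g(−e, r+1) = g(e, r+1)⁻¹` (the orientation rule of §1 p. 322 holds for (11.14)). [cite: Federbush1988PhaseCellIV, (11.14)
p. 339; §1 p. 322] -/
theorem nextApprox_swap (φ : X → G) (va vb : X) : nextApprox φ vb va = (nextApprox φ va vb)⁻¹ := by
  simp [nextApprox]

/-- (11.14) defines a PURE GAUGE: the cocycle identity `g(v_a v_b) g(v_b v_c) = g(v_a v_c)`, hence the ordered product around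
any closed lattice loop (in particular around every plaquette of level `> r` inside `H_i`) is the identity.
[cite: Federbush1988PhaseCellIV, (11.14) p. 339] -/
theorem nextApprox_mul_nextApprox (φ : X → G) (va vb vc : X) :
    nextApprox φ va vb * nextApprox φ vb vc = nextApprox φ va vc := by
  simp [nextApprox, mul_assoc]

/-- The plaquette product of (11.14) is trivial: `g(v₁v₂)g(v₂v₃)g(v₃v₄)g(v₄v₁) = 1`.
[cite: Federbush1988PhaseCellIV, (11.14) p. 339] -/
theorem nextApprox_plaquette (φ : X → G) (v₁ v₂ v₃ v₄ : X) :
    nextApprox φ v₁ v₂ * nextApprox φ v₂ v₃ * nextApprox φ v₃ v₄ * nextApprox φ v₄ v₁ = 1 := by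
  simp [nextApprox, mul_assoc]

/-- On the tree edges (11.14) reproduces the data `g(e)` of (11.2): if `φ_i` is a vertex gauge for `g` on `T`, then
`g(e, r+1) = g(e)` for `e ∈ T`. [cite: Federbush1988PhaseCellIV, (11.2) p. 337; (11.14) p. 339] -/
theorem nextApprox_eq_of_vertexGauge {V : Type*} {T : SimpleGraph V} {g : V → V → G} {φ : V → G}
    (hφ : ∀ a b, T.Adj a b → g a b = (φ a)⁻¹ * φ b) {a b : V} (hab : T.Adj a b) : nextApprox φ a b = g a b :=
  (hφ a b hab).symm

/-- A global change `φ_i ↦ uφ_i` (the ambiguity of (11.2)) does not change `g(e, r+1)`.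
[cite: Federbush1988PhaseCellIV, (11.2) p. 337; (11.14) p. 339] -/
theorem nextApprox_smul (φ : X → G) (u : G) (va vb : X) : nextApprox (u • φ) va vb = nextApprox φ va vb :=
  vertexGauge_smul φ u va vb

end Factorisation

/-! ## 4. Geometric Constructions 2 and 4 with print's `d^g` of (11.1) in (11.5)–(11.6) -/

section GaugeForm

variable (Γ : Type*) {t : ℕ}

/-- **Geometric Construction 2 with (11.1)'s `d^g`** — (11.5)–(11.6) p. 337 verbatim: «We extend `φ₂(x)` from a mapping on
`v_a` and `v_b` to a mapping from `e → G`, such that a) `d^g(ᵉφ₁, ᵉφ₂) ≤ c d^g(φ₁, φ₂)`, (11.5) b) `Λ₁(ᵉφ₂) ≤ c(Λ₁(ᵉφ₁) +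
d^g(φ₁, φ₂)/L_r + Λ₁(φ₂))`, (11.6)».  Same typing as the tree's `GeomConstruction2` (edge of length `L_r = ℓ` = closed ball of
radius `ℓ/2` in `ℝ¹`, end points = the sphere; embedded target `M ⊆ Rᵗ`; smallness hypothesis `d^g(φ₁, φ₂) ≤ ε` from Theorem
A.2; one `c`), but with `d^g = gaugeDist Γ` for a group `Γ` of global gauge transformations acting on `↥M` (print: `Γ = G`
by left multiplication) in place of the sup-distance.  `Prop`-valued definition; derived below from `GeomConstruction2`.
[cite: Federbush1988PhaseCellIV, (11.5)–(11.6) p. 337; (11.1) p. 336] -/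
def GeomConstruction2Gauge (t : ℕ) (M : Set (EuclideanSpace ℝ (Fin t))) [SMul Γ ↥M] : Prop :=
  ∃ ε : ℝ≥0, 0 < ε ∧ ∃ c : ℝ≥0, ∀ ℓ : ℝ, 0 < ℓ →
    ∀ (φ₁ φ₂ : ↥(sphere (0 : EuclideanSpace ℝ (Fin 1)) (ℓ / 2)) → ↥M)
      (eφ₁ : ↥(closedBall (0 : EuclideanSpace ℝ (Fin 1)) (ℓ / 2)) → ↥M),
      (∀ x : ↥(sphere (0 : EuclideanSpace ℝ (Fin 1)) (ℓ / 2)), eφ₁ ⟨x.1, sphere_subset_closedBall x.2⟩ = φ₁ x) →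
      gaugeDist Γ φ₁ φ₂ ≤ ε →
      ∃ eφ₂ : ↥(closedBall (0 : EuclideanSpace ℝ (Fin 1)) (ℓ / 2)) → ↥M,
        (∀ x : ↥(sphere (0 : EuclideanSpace ℝ (Fin 1)) (ℓ / 2)), eφ₂ ⟨x.1, sphere_subset_closedBall x.2⟩ = φ₂ x) ∧
        gaugeDist Γ eφ₁ eφ₂ ≤ c * gaugeDist Γ φ₁ φ₂ ∧
        lipConst eφ₂ ≤ c * (lipConst eφ₁ + gaugeDist Γ φ₁ φ₂ / ENNReal.ofReal ℓ + lipConst φ₂)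

/-- **Geometric Construction 4 with (11.1)'s `d^g`** p. 338: «We extend `φ₂(x)` on `∂D` to `ᵉφ₂(x)` on `D`, satisfying (11.5)
and (11.6)» — as the tree's `GeomConstruction4` (unit `k`-cube, unit scale, embedded target) with `d^g = gaugeDist Γ`.
`Prop`-valued definition; derived below from `GeomConstruction4`. [cite: Federbush1988PhaseCellIV, Geometric Construction 4
p. 338; (11.5)–(11.6) p. 337; (11.1) p. 336] -/
def GeomConstruction4Gauge (k t : ℕ) (M : Set (EuclideanSpace ℝ (Fin t))) [SMul Γ ↥M] : Prop :=
  ∃ ε : ℝ≥0, 0 < ε ∧ ∃ c : ℝ≥0,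
    ∀ (φ₁ φ₂ : ↥(cubeBoundary k) → ↥M) (eφ₁ : ↥(unitCube k) → ↥M),
      (∀ x : ↥(cubeBoundary k), eφ₁ ⟨x.1, cubeBoundary_subset k x.2⟩ = φ₁ x) →
      gaugeDist Γ φ₁ φ₂ ≤ ε →
      ∃ eφ₂ : ↥(unitCube k) → ↥M,
        (∀ x : ↥(cubeBoundary k), eφ₂ ⟨x.1, cubeBoundary_subset k x.2⟩ = φ₂ x) ∧
        gaugeDist Γ eφ₁ eφ₂ ≤ c * gaugeDist Γ φ₁ φ₂ ∧
        lipConst eφ₂ ≤ c * (lipConst eφ₁ + gaugeDist Γ φ₁ φ₂ + lipConst φ₂)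

variable {Γ}

/-- The common mechanism behind `GeomConstruction2.gauge` / `GeomConstruction4.gauge`: an extension statement with the
sup-distance, applied to the globally rotated pair `(uφ₁, uᵉφ₁; φ₂)` with `u` attaining the infimum of (11.1), yields the
statement with `d^g` and the SAME constants — because `Λ₁(uᵉφ₁) = Λ₁(ᵉφ₁)` (isometric action) and `d^g(ᵉφ₁, ᵉφ₂) ≤
d^M(uᵉφ₁, ᵉφ₂)`. [cite: Federbush1988PhaseCellIV, (11.1) p. 336; (11.5)–(11.6) p. 337] -/
theorem gauge_of_supDist_version {A B : Type*} [PseudoEMetricSpace A] [PseudoEMetricSpace B] {M : Set (EuclideanSpace ℝ (Fin t))}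
    [Group Γ] [MulAction Γ ↥M] [IsIsometricSMul Γ ↥M] [TopologicalSpace Γ] [CompactSpace Γ] [ContinuousSMul Γ ↥M]
    (ι : A → B) {ε c : ℝ≥0} {D : ℝ≥0∞}
    (h : ∀ (φ₁ φ₂ : A → ↥M) (eφ₁ : B → ↥M), (∀ x, eφ₁ (ι x) = φ₁ x) → supDist φ₁ φ₂ ≤ ε →
      ∃ eφ₂ : B → ↥M, (∀ x, eφ₂ (ι x) = φ₂ x) ∧ supDist eφ₁ eφ₂ ≤ c * supDist φ₁ φ₂ ∧
        lipConst eφ₂ ≤ c * (lipConst eφ₁ + supDist φ₁ φ₂ / D + lipConst φ₂))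
    (φ₁ φ₂ : A → ↥M) (eφ₁ : B → ↥M) (hext : ∀ x, eφ₁ (ι x) = φ₁ x) (hε : gaugeDist Γ φ₁ φ₂ ≤ ε) :
    ∃ eφ₂ : B → ↥M, (∀ x, eφ₂ (ι x) = φ₂ x) ∧ gaugeDist Γ eφ₁ eφ₂ ≤ c * gaugeDist Γ φ₁ φ₂ ∧
      lipConst eφ₂ ≤ c * (lipConst eφ₁ + gaugeDist Γ φ₁ φ₂ / D + lipConst φ₂) := by
  have : Nonempty Γ := ⟨1⟩
  obtain ⟨u, hu⟩ := exists_gaugeDist_eq (Γ := Γ) φ₁ φ₂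
  obtain ⟨eφ₂, h1, h2, h3⟩ := h (u • φ₁) φ₂ (u • eφ₁) (fun x => by simp [Pi.smul_apply, hext x]) (hu ▸ hε)
  refine ⟨eφ₂, h1, ?_, ?_⟩
  · exact (gaugeDist_le_supDist_smul u eφ₁ eφ₂).trans (hu ▸ h2)
  · rwa [lipConst_smul, ← hu] at h3

/-- **Geometric Construction 2 in print's form from the tree's sup-distance form**: `GeomConstruction2 t M →
GeomConstruction2Gauge Γ t M` (same `ε`, same `c`) for every compact group `Γ` of global gauge transformations acting
isometrically and continuously on `↥M`. [cite: Federbush1988PhaseCellIV, (11.5)–(11.6) p. 337; (11.1) p. 336] -/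
theorem _root_.Literature.MathematicalPhysics.QuantumFieldTheory.Federbush1986.PhaseCellIVAppA.GeomConstruction2.gauge
    {M : Set (EuclideanSpace ℝ (Fin t))} [Group Γ] [MulAction Γ ↥M] [IsIsometricSMul Γ ↥M] [TopologicalSpace Γ]
    [CompactSpace Γ] [ContinuousSMul Γ ↥M] (h : GeomConstruction2 t M) : GeomConstruction2Gauge Γ t M := by
  obtain ⟨ε, hε, c, hc⟩ := h
  refine ⟨ε, hε, c, fun ℓ hℓ φ₁ φ₂ eφ₁ hext hd => ?_⟩
  exact gauge_of_supDist_version (fun x : ↥(sphere (0 : EuclideanSpace ℝ (Fin 1)) (ℓ / 2)) =>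
    (⟨x.1, sphere_subset_closedBall x.2⟩ : ↥(closedBall (0 : EuclideanSpace ℝ (Fin 1)) (ℓ / 2))))
    (hc ℓ hℓ) φ₁ φ₂ eφ₁ hext hd

/-- **Geometric Construction 4 in print's form from the tree's sup-distance form**: `GeomConstruction4 k t M →
GeomConstruction4Gauge Γ k t M`. [cite: Federbush1988PhaseCellIV, Geometric Construction 4 p. 338; (11.1) p. 336] -/
theorem _root_.Literature.MathematicalPhysics.QuantumFieldTheory.Federbush1986.PhaseCellIVAppA.GeomConstruction4.gauge
    {k : ℕ} {M : Set (EuclideanSpace ℝ (Fin t))} [Group Γ] [MulAction Γ ↥M] [IsIsometricSMul Γ ↥M] [TopologicalSpace Γ]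
    [CompactSpace Γ] [ContinuousSMul Γ ↥M] (h : GeomConstruction4 k t M) : GeomConstruction4Gauge Γ k t M := by
  obtain ⟨ε, hε, c, hc⟩ := h
  refine ⟨ε, hε, c, fun φ₁ φ₂ eφ₁ hext hd => ?_⟩
  have hc' := fun (φ₁ φ₂ : ↥(cubeBoundary k) → ↥M) (eφ₁ : ↥(unitCube k) → ↥M)
      (he : ∀ x : ↥(cubeBoundary k), eφ₁ ⟨x.1, cubeBoundary_subset k x.2⟩ = φ₁ x) (hs : supDist φ₁ φ₂ ≤ ε) =>
    show ∃ eφ₂ : ↥(unitCube k) → ↥M, (∀ x : ↥(cubeBoundary k), eφ₂ ⟨x.1, cubeBoundary_subset k x.2⟩ = φ₂ x) ∧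
        supDist eφ₁ eφ₂ ≤ c * supDist φ₁ φ₂ ∧ lipConst eφ₂ ≤ c * (lipConst eφ₁ + supDist φ₁ φ₂ / 1 + lipConst φ₂) by
      simpa only [div_one] using hc φ₁ φ₂ eφ₁ he hs
  simpa only [div_one] using gauge_of_supDist_version
    (fun x : ↥(cubeBoundary k) => (⟨x.1, cubeBoundary_subset k x.2⟩ : ↥(unitCube k))) hc' φ₁ φ₂ eφ₁ hext hd

/-- Constructions 2 and 4 in print's `d^g` form hold for EVERY compact `C^∞` submanifold `M ⊂ Rᵗ` (print's «compact
differentiable manifold … embedded in `R^t`») carrying an isometric continuous action of a compact group `Γ` — from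
`geomConstruction2_of_submanifold` (p299964) and `geomConstruction4_of_submanifold` (p299476).
[cite: Federbush1988PhaseCellIV, (11.5)–(11.6) p. 337; Geometric Construction 4 p. 338; Theorem A.2 p. 341] -/
theorem geomConstruction2Gauge_and_4Gauge_of_geomConstructions {k : ℕ} {M : Set (EuclideanSpace ℝ (Fin t))} [Group Γ]
    [MulAction Γ ↥M] [IsIsometricSMul Γ ↥M] [TopologicalSpace Γ] [CompactSpace Γ] [ContinuousSMul Γ ↥M]
    (h2 : GeomConstruction2 t M) (h4 : GeomConstruction4 k t M) :
    GeomConstruction2Gauge Γ t M ∧ GeomConstruction4Gauge Γ k t M :=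
  ⟨h2.gauge, h4.gauge⟩

/-- The `d^g` form implies back a WEAK sup-distance form: since `d^g ≤ d^M`, the hypothesis `d^M(φ₁, φ₂) ≤ ε` suffices and
the conclusions hold with `d^g` (which is what §11 uses). [cite: Federbush1988PhaseCellIV, (11.1) p. 336; (11.5)–(11.6) p. 337] -/
theorem GeomConstruction4Gauge.of_supDist_le {k : ℕ} {M : Set (EuclideanSpace ℝ (Fin t))} [Monoid Γ] [MulAction Γ ↥M]
    (h : GeomConstruction4Gauge Γ k t M) :
    ∃ ε : ℝ≥0, 0 < ε ∧ ∃ c : ℝ≥0, ∀ (φ₁ φ₂ : ↥(cubeBoundary k) → ↥M) (eφ₁ : ↥(unitCube k) → ↥M),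
      (∀ x : ↥(cubeBoundary k), eφ₁ ⟨x.1, cubeBoundary_subset k x.2⟩ = φ₁ x) → supDist φ₁ φ₂ ≤ ε →
      ∃ eφ₂ : ↥(unitCube k) → ↥M, (∀ x : ↥(cubeBoundary k), eφ₂ ⟨x.1, cubeBoundary_subset k x.2⟩ = φ₂ x) ∧
        gaugeDist Γ eφ₁ eφ₂ ≤ c * supDist φ₁ φ₂ ∧ lipConst eφ₂ ≤ c * (lipConst eφ₁ + supDist φ₁ φ₂ + lipConst φ₂) := by
  obtain ⟨ε, hε, c, hc⟩ := h
  refine ⟨ε, hε, c, fun φ₁ φ₂ eφ₁ hext hs => ?_⟩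
  obtain ⟨eφ₂, h1, h2, h3⟩ := hc φ₁ φ₂ eφ₁ hext ((gaugeDist_le_supDist φ₁ φ₂).trans hs)
  exact ⟨eφ₂, h1, h2.trans (by gcongr; exact gaugeDist_le_supDist φ₁ φ₂),
    h3.trans (by gcongr; exact gaugeDist_le_supDist φ₁ φ₂)⟩

end GaugeForm

/-! ## 5. Geometric Constructions 5 and 6: (11.10)–(11.11) and (11.12)–(11.13), typed at unit scale -/

section Smoothing

/-- **Geometric Construction 5** p. 338, verbatim: «`ᵉˢφ′` is a smoothing of `ᵉφ′`.  *Geometric Construction 5.* `ᵉˢφ′(x)`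
satisfies a) `ᵉˢφ′(x) = ᵉφ′(x)`, `x ∈ ∂H`, (11.10) b) `|D^α ᵉˢφ′(x)| ≤ c_α (1/(d(x, ∂D))^{|α|−1}) Λ₁(ᵉφ′)`, (11.11) where the
norm on derivatives in the left side of (11.11) is any reasonable `L_∞` norm.»  TYPING («as scaled to unit scale», Caution
p. 339): `H = D` = the unit `k`-cube `unitCube k` (print writes `∂H` in (11.10) and `∂D` in (11.11) for the boundary of the
same hypercube), `ᵉφ′ : H → M` a (Lipschitz) map into the embedded target `M ⊆ Rᵗ`, `ᵉˢφ′` an ambient map `ℝᵏ → Rᵗ` with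
values in `M` on `H`, continuous on `H`, `C^∞` on the open cube, equal to `ᵉφ′` on `∂H` (11.10), and (11.11) for every
order `m = |α| ≥ 1` as `‖iteratedFDeriv ℝ m ᵉˢφ′ x‖ ≤ c_m d(x, ∂H)^{−(m−1)} K` for every Lipschitz constant `K ≤ c₁` of `ᵉφ′`,
the `c_m = c_m(c₁)` chosen before the map (the cap `c₁` = the Caution, exactly as in `ThmA3ContCap`, whose ball version this
is).  `Prop`-valued definition, NOT asserted. [cite: Federbush1988PhaseCellIV, Geometric Construction 5 (11.10)–(11.11)
p. 338; Caution p. 339] -/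
def GeomConstruction5 (k t : ℕ) (M : Set (EuclideanSpace ℝ (Fin t))) : Prop :=
  ∀ c₁ : ℝ≥0, ∃ c : ℕ → ℝ, ∀ eφ : ↥(unitCube k) → ↥M, (∃ K : ℝ≥0, K ≤ c₁ ∧ LipschitzWith K eφ) →
    ∃ esφ : EuclideanSpace ℝ (Fin k) → EuclideanSpace ℝ (Fin t),
      MapsTo esφ (unitCube k) M ∧
      (∀ x : ↥(cubeBoundary k), esφ x = (eφ ⟨x.1, cubeBoundary_subset k x.2⟩ : EuclideanSpace ℝ (Fin t))) ∧
      ContinuousOn esφ (unitCube k) ∧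
      ContDiffOn ℝ ∞ esφ (interior (unitCube k)) ∧
      ∀ m : ℕ, 1 ≤ m → ∀ K : ℝ≥0, K ≤ c₁ → LipschitzWith K eφ →
        ∀ x ∈ interior (unitCube k),
          ‖iteratedFDeriv ℝ m esφ x‖ ≤ c m * ((infDist x (cubeBoundary k))⁻¹ ^ (m - 1)) * K

/-- **Geometric Construction 6** p. 338–339, verbatim: «We finally consider `φ′(x)` defined on `∂H` of hypercube `H` where `φ′`
is not a homotopically trivial map from `∂H` to `G`.  In this case we find an extension, discontinuous at one point `x₀`. …
*Geometric Construction 6.* `ᵉφ′(x)` defined on `H − x₀`, as an extension of `φ′(x)` defined on `∂H`, satisfies a) `ᵉφ′(x) =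
φ′(x)`, `x ∈ ∂H`, (11.12) b) `|D^α ᵉφ′(x)| ≤ c_α · Max(1/(d(x, ∂D))^{|α|−1}, 1/(d(x, x₀))^{|α|−1}) · (L_r/d(x, x₀)) · Λ₁(φ′)`.
(11.13)»  TYPING at unit scale (`L_r = 1`) on the unit `k`-cube `H = unitCube k`, embedded target: the singular point `x₀`
ranges over the points within `δ` of the centre `c(H)` of the cube («Centering Property» p. 338: `d(x₀, c(H)) ≤ L_{r+1}`, i.e.
`δ = 1/N` at unit scale; the property's multi-level clause is typed with §1), `φ′ : ∂H → M` Lipschitz with constant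
`K ≤ c₁` (Caution), `ᵉφ′` an ambient map with values in `M` on `H − x₀`, continuous there, `C^∞` on the open cube minus
`x₀`, equal to `φ′` on `∂H` (11.12), and (11.13) for every order `m = |α| ≥ 1` with `max (d(x, ∂H)^{−(m−1)}) (d(x, x₀)^{−(m−1)})`
and the factor `1/d(x, x₀)`; constants `c_m = c_m(c₁, δ)`.  Ball version = `ThmA4ContCap`.  `Prop`-valued definition, NOT
asserted. [cite: Federbush1988PhaseCellIV, Geometric Construction 6 (11.12)–(11.13) p. 338–339; Caution p. 339] -/
def GeomConstruction6 (k t : ℕ) (M : Set (EuclideanSpace ℝ (Fin t))) (δ : ℝ) : Prop :=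
  ∀ c₁ : ℝ≥0, ∃ c : ℕ → ℝ, ∀ x₀ : EuclideanSpace ℝ (Fin k), dist x₀ (CubeBall.center k) ≤ δ →
    ∀ φ : ↥(cubeBoundary k) → ↥M, (∃ K : ℝ≥0, K ≤ c₁ ∧ LipschitzWith K φ) →
      ∃ eφ : EuclideanSpace ℝ (Fin k) → EuclideanSpace ℝ (Fin t),
        MapsTo eφ (unitCube k \ {x₀}) M ∧
        (∀ x : ↥(cubeBoundary k), eφ x = (φ x : EuclideanSpace ℝ (Fin t))) ∧
        ContinuousOn eφ (unitCube k \ {x₀}) ∧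
        ContDiffOn ℝ ∞ eφ (interior (unitCube k) \ {x₀}) ∧
        ∀ m : ℕ, 1 ≤ m → ∀ K : ℝ≥0, K ≤ c₁ → LipschitzWith K φ →
          ∀ x ∈ interior (unitCube k) \ {x₀},
            ‖iteratedFDeriv ℝ m eφ x‖ ≤
              c m * max ((infDist x (cubeBoundary k))⁻¹ ^ (m - 1)) ((dist x x₀)⁻¹ ^ (m - 1)) * (dist x x₀)⁻¹ * K

/-- Geometric Construction 6 is monotone in the centering radius: a smaller `δ` asks less.
[cite: Federbush1988PhaseCellIV, Geometric Construction 6 p. 338–339] -/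
theorem GeomConstruction6.mono {k t : ℕ} {M : Set (EuclideanSpace ℝ (Fin t))} {δ δ' : ℝ} (hδ : δ' ≤ δ)
    (h : GeomConstruction6 k t M δ) : GeomConstruction6 k t M δ' := by
  intro c₁
  obtain ⟨c, hc⟩ := h c₁
  exact ⟨c, fun x₀ hx₀ => hc x₀ (hx₀.trans hδ)⟩

/-- Construction 5 is monotone in the cap: constants chosen for the cap `c₁` serve every smaller cap (the Caution's «universal
bound on `Λ₁`» may be enlarged). [cite: Federbush1988PhaseCellIV, Geometric Construction 5 p. 338; Caution p. 339] -/
theorem GeomConstruction5.of_le_cap {k t : ℕ} {M : Set (EuclideanSpace ℝ (Fin t))} (h : GeomConstruction5 k t M)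
    {c₁ c₁' : ℝ≥0} (hc : c₁' ≤ c₁) :
    ∃ c : ℕ → ℝ, ∀ eφ : ↥(unitCube k) → ↥M, (∃ K : ℝ≥0, K ≤ c₁' ∧ LipschitzWith K eφ) →
      ∃ esφ : EuclideanSpace ℝ (Fin k) → EuclideanSpace ℝ (Fin t),
        MapsTo esφ (unitCube k) M ∧
        (∀ x : ↥(cubeBoundary k), esφ x = (eφ ⟨x.1, cubeBoundary_subset k x.2⟩ : EuclideanSpace ℝ (Fin t))) ∧
        ContinuousOn esφ (unitCube k) ∧
        ContDiffOn ℝ ∞ esφ (interior (unitCube k)) ∧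
        ∀ m : ℕ, 1 ≤ m → ∀ K : ℝ≥0, K ≤ c₁' → LipschitzWith K eφ →
          ∀ x ∈ interior (unitCube k),
            ‖iteratedFDeriv ℝ m esφ x‖ ≤ c m * ((infDist x (cubeBoundary k))⁻¹ ^ (m - 1)) * K := by
  obtain ⟨c, hc'⟩ := h c₁
  refine ⟨c, fun eφ hK => ?_⟩
  obtain ⟨K, hK1, hK2⟩ := hK
  obtain ⟨esφ, h1, h2, h3, h4, h5⟩ := hc' eφ ⟨K, hK1.trans hc, hK2⟩
  exact ⟨esφ, h1, h2, h3, h4, fun m hm K' hK' hL => h5 m hm K' (hK'.trans hc) hL⟩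

end Smoothing

end PhaseCellIVGauge

end

end Literature.MathematicalPhysics.QuantumFieldTheory.Federbush1986
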